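import Summits.NavierStokesRegularity.NavierStokesRegularity.Theses.FilamentSkeletonRss
import Summits.NavierStokesRegularity.NavierStokesRegularity.Theorems.FilamentSkeletonRssRdssProfileTruncation
import Summits.NavierStokesRegularity.NavierStokesRegularity.Theorems.FilamentSkeletonRssCoreGluingProfileSuffices

/-!
# Route `FilamentSkeletonRss` · crux `CoreGluing` (stmt-NavierStokesRegularity-15401) — route-level reduction

Line `Sketch`, lead c3 (cycle 4).  Four short theorems that pin down, INSIDE THE TREE, what the crux
`CoreGluing := SkeletonEquilibrium → RssProfileExists` still owes once the route's other items have
landed (`RdssProfileTruncation` = stmt-11289, proved by `filamentSkeletonRss_rdssProfileTruncation_proof`;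
`Assembly` = stmt-16007 = the deciding theorem `closes`; the bookkeeping half of the crux,
`stub_rssProfileExists_of_profile`, p130189):

* `rssProfileExists_not_navierStokesRegularity` — the route TARGET alone already decides the summit
  negatively: an RSS profile in the route's rendering refutes `NavierStokesRegularity`.  The proof is
  the body of `closes` with the truncation bridge DISCHARGED by the tree theorem; neither
  `SkeletonEquilibrium` (K1) nor `CoreGluing` (K2) is used.  Hence the route's whole open content is
  `RssProfileExists` (¬ Tsai Conj. 8.9 / Pineau–Vicol Conj. 1.1 in the window), and K1/K2 are a
  MECHANISM for producing it, not logically separate obligations.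
* `rotatedLerayProfile_not_navierStokesRegularity` — the same in PDE form: ONE smooth nontrivial
  solution `(U, P)` of Perelman's rotated Leray profile system
  `α(JU − DU[Jy]) + ½U + ½DU[y] − ΔU + DU[U] + ∇P = 0`, `∇·U = 0`, `α ≠ 0`, with `‖U y‖ ≤ C₀/(1+‖y‖)`
  and bounded pressure, refutes `NavierStokesRegularity` (composition with p130189).  This is exactly
  the conclusion of the line's one open stub `stub_rssProfileFromSkeleton`.
* `skeletonEquilibrium_coreGluing_not_navierStokesRegularity` — the deciding theorem with the bridge
  discharged: the route is closed modulo K1 ∧ K2.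
* `coreGluing_iff_rssProfileExists_of_skeletonEquilibrium` — once K1 holds, K2 IS the target
  (its hypothesis is then discharged and carries no usable structure: compare
  `CoreGluing.Negative.skeletonEquilibrium_holds_below_drift`, p128789, for the clause analysis).

These are the formal content of the leads' verdict (c1 promote-stub, c2/c3 misstated): as filed, K2 is
`RssProfileExists` plus landed bookkeeping, conditioned on a hypothesis that exports nothing a gluing
argument consumes (no Γ-uniform bounds, no ellipticity, no non-degeneracy, α untied).
-/

set_option linter.dupNamespace false

noncomputable section

namespace Summit.NavierStokesRegularity.NavierStokesRegularity.Theorems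

open Set Function Filter MeasureTheory
open Summit.NavierStokesRegularity.NavierStokesRegularity.Theses.FilamentSkeletonRss
open Literature.Analysis.FluidPDE Literature.Analysis.FluidPDE.PineauVicol2026
open scoped RealInnerProductSpace Laplacian ContDiff Topology

/-- **The target decides the summit.**  `RssProfileExists → ¬ NavierStokesRegularity`: an ancient mild,
Type-I, rotated-self-similar (every factor `c > 0`, pinned rotations about `e₃`) Navier–Stokes field with a
nontrivial `C²` slice at `t = −1` refutes global regularity.  Proof = the route's deciding theorem `closes`
with `RdssProfileTruncation` supplied by the tree theorem `filamentSkeletonRss_rdssProfileTruncation_proof`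
(stmt-11289): at `c = 2` the field is rotated-DSS and not a.e. zero at `t = −1`, so the truncation bridge
gives a rapidly decaying datum with a Leray–Hopf classical solution of finite maximal lifespan `T`; Clay (A)
plus the proved Clay-class uniqueness `blowup_clay_uniqueness` (stmt-0153) extend it past `T`.  Neither
`SkeletonEquilibrium` nor `CoreGluing` enters. -/
theorem rssProfileExists_not_navierStokesRegularity (h : RssProfileExists) :
    ¬ _root_.NavierStokesRegularity := by
  obtain ⟨α, C₀, U, Rot, u, -, -, hU2, hU0, hu1, hrss, hmild, hmeas, hC⟩ := h
  -- an RSS field is rotated discretely self-similar for every factor; take c = 2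
  have hrdss : IsRotatedDSS 2 (Rot (-(α * (2 * Real.log 2)))) u := hrss 2 two_pos
  -- nontriviality on t < 0: the slice at t = -1 is U itself, continuous and ≠ 0
  have hnz : ¬ (∀ t < 0, u t =ᵐ[volume] 0) := by
    intro h0
    have h1 := h0 (-1) (by norm_num)
    rw [hu1] at h1
    exact hU0 ((Continuous.ae_eq_iff_eq volume hU2.continuous continuous_const).1 h1)
  -- X5a via the PROVED truncation bridge
  obtain ⟨ν, hν, T, hT, v, q, ⟨hcl, hmax⟩, hLH, hdec⟩ :=
    filamentSkeletonRss_rdssProfileTruncation_proof ⟨2, _, _, one_lt_two, hmild, hmeas, hrdss, ⟨C₀, hC⟩, hnz⟩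
  intro hA
  have h0 : (0 : ℝ) ∈ Set.Ico 0 T := ⟨le_rfl, hT⟩
  -- Clay (A) from that datum: a global class-(A) solution `(u', p')`
  obtain ⟨u', p', hu', hp', hns, hbe⟩ :=
    hA ν hν (v 0) (hcl.contDiff_velocity h0) (hcl.divFree 0 h0) hdec
  -- Clay-class uniqueness on [0, T) (stmt-0153, proved in tree)
  have heq : ∀ t ∈ Set.Ico 0 T, u' t = v t :=
    blowup_clay_uniqueness ν hν (v 0) hdec u' v p' q T hT hu' hp' hns hbe hcl hLH rfl
  -- so the blowing-up solution extends classically past its maximal lifespan: contradiction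
  have hcl' : IsClassicalNSSolutionOn (Set.Ici 0) ν 0 u' p' :=
    ⟨hu', hp', fun t ht x => hns.momentum t ht x, fun t ht => hns.divFree t ht⟩
  refine hmax ⟨T + 1, by linarith, u', p', ?_, heq⟩
  exact hcl'.mono (fun t ht => ht.1) (uniqueDiffOn_Ico 0 (T + 1))

/-- **PDE form.**  One smooth nontrivial solution `(U, P)` of the rotated Leray profile system
(Pineau–Vicol 2026, (1.8)) with angular speed `α ≠ 0`, profile Type-I decay `‖U y‖ ≤ C₀/(1+‖y‖)` and
bounded pressure refutes `NavierStokesRegularity`: `stub_rssProfileExists_of_profile` (p130189) followed by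
`rssProfileExists_not_navierStokesRegularity`.  The hypothesis is verbatim the conclusion of the line's open
stub `stub_rssProfileFromSkeleton`, so that stub alone — without any skeleton — would close the route. -/
theorem rotatedLerayProfile_not_navierStokesRegularity
    (h : ∃ (α C₀ M : ℝ) (U : EuclideanSpace ℝ (Fin 3) → EuclideanSpace ℝ (Fin 3))
      (P : EuclideanSpace ℝ (Fin 3) → ℝ), α ≠ 0 ∧ U ≠ 0 ∧ ContDiff ℝ (⊤ : ℕ∞) U ∧ ContDiff ℝ (⊤ : ℕ∞) P ∧
      VectorCalculus.IsDivFree U ∧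
      (∀ y : EuclideanSpace ℝ (Fin 3), α • (rotGen (U y) - fderiv ℝ U y (rotGen y)) + (1 / 2 : ℝ) • U y +
        (1 / 2 : ℝ) • fderiv ℝ U y y - (Δ U) y + fderiv ℝ U y (U y) + gradient P y = 0) ∧
      (∀ y : EuclideanSpace ℝ (Fin 3), ‖U y‖ ≤ C₀ / (1 + ‖y‖)) ∧
      (∀ y : EuclideanSpace ℝ (Fin 3), |P y| ≤ M)) :
    ¬ _root_.NavierStokesRegularity :=
  rssProfileExists_not_navierStokesRegularity (stub_rssProfileExists_of_profile h)

/-- **The route is closed modulo K1 ∧ K2.**  The deciding theorem `closes` with its third hypothesis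
`RdssProfileTruncation` discharged by the tree theorem (stmt-11289). -/
theorem skeletonEquilibrium_coreGluing_not_navierStokesRegularity
    (hK1 : SkeletonEquilibrium) (hK2 : CoreGluing) : ¬ _root_.NavierStokesRegularity :=
  -- buildfix 2026-08-19 (ops-buildfix lane): `closes` was re-cut (rev ≥ 2026-08-17: SelectionBoxR /
  -- CoreLinearInvertibility / CoreGluingGivenInvertibilityQR / BoxSelectionR / RdssProfileTruncation), so
  -- `closes hK1 hK2 …` no longer elaborates; K2 applied to K1 is `RssProfileExists`, and the tree theorem
  -- `rssProfileExists_not_navierStokesRegularity` (truncation bridge discharged inside) refutes Clay (A).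
  rssProfileExists_not_navierStokesRegularity (hK2 hK1)

/-- **Given the skeleton, the crux IS the target.**  If `SkeletonEquilibrium` (K1, stmt-15400) holds then
`CoreGluing ↔ RssProfileExists`: the implication's hypothesis is discharged, and — being a closed
proposition with no variable shared with the conclusion — it hands the prover no structure to glue from.
Together with `CoreGluing.Negative.not_coreGluing_iff` (`¬CoreGluing ↔ K1 ∧ ¬RssProfileExists`) this is
the formal shape of the misstatement recorded by the line leads. -/
theorem coreGluing_iff_rssProfileExists_of_skeletonEquilibrium (hK1 : SkeletonEquilibrium) :
    CoreGluing ↔ RssProfileExists :=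
  ⟨fun h => h hK1, fun h _ => h⟩

/-- Registered tools stub of crux stmt-NavierStokesRegularity-15401 (`ledger workitem stub-add … --name
stub_routeReductionTools`): the conjunction of the four reduction theorems of this file. [folklore] -/
theorem stub_routeReductionTools : (Summit.NavierStokesRegularity.NavierStokesRegularity.Theses.FilamentSkeletonRss.RssProfileExists → ¬ _root_.NavierStokesRegularity) ∧ ((∃ (α C₀ M : ℝ) (U : EuclideanSpace ℝ (Fin 3) → EuclideanSpace ℝ (Fin 3)) (P : EuclideanSpace ℝ (Fin 3) → ℝ), α ≠ 0 ∧ U ≠ 0 ∧ ContDiff ℝ (⊤ : ℕ∞) U ∧ ContDiff ℝ (⊤ : ℕ∞) P ∧ VectorCalculus.IsDivFree U ∧ (∀ y : EuclideanSpace ℝ (Fin 3), α • (rotGen (U y) - fderiv ℝ U y (rotGen y)) + (1 / 2 : ℝ) • U y + (1 / 2 : ℝ) • fderiv ℝ U y y - (Δ U) y + fderiv ℝ U y (U y) + gradient P y = 0) ∧ (∀ y : EuclideanSpace ℝ (Fin 3), ‖U y‖ ≤ C₀ / (1 + ‖y‖)) ∧ (∀ y : EuclideanSpace ℝ (Fin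 3), |P y| ≤ M)) → ¬ _root_.NavierStokesRegularity) ∧ (Summit.NavierStokesRegularity.NavierStokesRegularity.Theses.FilamentSkeletonRss.SkeletonEquilibrium → Summit.NavierStokesRegularity.NavierStokesRegularity.Theses.FilamentSkeletonRss.CoreGluing → ¬ _root_.NavierStokesRegularity) ∧ (Summit.NavierStokesRegularity.NavierStokesRegularity.Theses.FilamentSkeletonRss.SkeletonEquilibrium → (Summit.NavierStokesRegularity.NavierStokesRegularity.Theses.FilamentSkeletonRss.CoreGluing ↔ Summit.NavierStokesRegularity.NavierStokesRegularity.Theses.FilamentSkeletonRss.RssProfileExists)) :=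
  ⟨rssProfileExists_not_navierStokesRegularity, rotatedLerayProfile_not_navierStokesRegularity,
    skeletonEquilibrium_coreGluing_not_navierStokesRegularity,
    coreGluing_iff_rssProfileExists_of_skeletonEquilibrium⟩

end Summit.NavierStokesRegularity.NavierStokesRegularity.Theorems

end
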